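import Summits.ResolutionOfSingularities.ResolutionOfSingularities.Theorems.FrobeniusLadderFInjectiveMacaulayficationBlowupFiModelOfCover
import Summits.ResolutionOfSingularities.ResolutionOfSingularities.Theorems.FrobeniusLadderFInjectiveMacaulayficationReesCoverOfPowers
import Summits.ResolutionOfSingularities.ResolutionOfSingularities.Theorems.FrobeniusLadderFInjectiveMacaulayficationClauseOfMaximal
import Summits.ResolutionOfSingularities.ResolutionOfSingularities.Theorems.FrobeniusLadderFInjectiveMacaulayficationHypersurfacePointBlowup
import Mathlib.RingTheory.Jacobson.Ring
import Mathlib.RingTheory.MvPolynomial.WeightedHomogeneous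
import Mathlib.Algebra.CharP.Algebra
import HarnessLib

/-!
# The weighted cone engine, core form: the blow-up of `I_N` from chartwise certificates
# (crux `FInjectiveMacaulayfication`, line `Sketch`, §15)

Support file for crux stmt-ResolutionOfSingularities-15315 (`FrobeniusLadder.FInjectiveMacaulayfication`,
registered skeleton 10f06f91, line `Sketch`, §15 THE WEIGHTED CONE ENGINE; lead seat res-L1-w45a-lead-1,
chain w45a). Let `k` be a field of characteristic `p`, `S = k[X₀,…,X_{n-1}]` with weights `w : Fin n → ℕ`,
`N > 0` with `N = c_v · w_v` for every variable, and `I_N ⊆ S` the monomial ideal spanned by the monomials of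
weighted degree `≥ N`, assumed to satisfy the Veronese saturation `X^b ∈ I_N^K` whenever `wt b ≥ K·N`. For a
prime `f` with all `x̄_v ≠ 0` in `R = S/(f)`, THE CORE THEOREM `weightedConeFiModel_of_chartClause` says:
if `R` satisfies the per-stalk clause of the crux at its closed points off the origin, and every affine
blow-up algebra `R[I_N R / x̄_v^{c_v}] ⊆ R[1/x̄_v]` satisfies the Cohen–Macaulay + Frobenius-closed clause at
its maximal ideals containing `x̄_v^{c_v}`, then `affineBlowup (I_N R)` — the weighted blow-up of the origin —
is an F-injective Macaulayfication of `Spec R` (proper, birational, every stalk a domain with the clause).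

Proof: E6‴ `BlowupFiModelOfCover.stub_blowupFiModelOfCover` on the sub-family `v_j = x̄_j^{c_j}`, which
covers `Bl_{I_N}` by `ReesCoverOfPowers.stub_reesCoverOfPowers` — for a generator `x̄^b` (`wt b ≥ N`, so some
`b_j ≥ 1`) one has `(x̄^b)^{c_j} = x̄_j^{c_j} · x̄^{b'}` with `wt b' = c_j·wt b − N ≥ (c_j − 1)N`, whence
`x̄^{b'} ∈ I_N^{c_j-1}` by saturation; the primes `P ⊉ I_N R` are handled by the Jacobson property of `R`
(`exists_maximal_not_mem_X`: such a `P` lies in a maximal ideal missing some `x̄_j`, since `I_N ⊆ (X)` and a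
prime of a Jacobson ring is the intersection of the maximal ideals above it) and
`ClauseOfMaximal.fiClause_atPrime_of_le`; `n = 0` is the regular case `R ≅ k`
(`HypersurfacePointBlowup.isRegularRing_of_isEmpty`). The registered stub #23 `stub_weightedConeFiModel` is
this theorem composed with the chart clause #22 `stub_weightedChartClause` (separate file).
-/

set_option linter.dupNamespace false

open AlgebraicGeometry CategoryTheory Literature.AlgebraicGeometry.Resolution MvPolynomial

namespace Summit.ResolutionOfSingularities.ResolutionOfSingularities.Theorems.FInjectiveMacaulayfication.WeightedConeCore

/-- A monomial of weighted degree `≥ N` lies in the monomial ideal `I_N`. [folklore] -/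
theorem monomial_mem_weightIdeal {k : Type} [Field k] {n : ℕ} (w : Fin n → ℕ) (N : ℕ) (b : Fin n →₀ ℕ)
    (hb : N ≤ Finsupp.weight w b) :
    (monomial b (1 : k) : MvPolynomial (Fin n) k) ∈
      Ideal.span {m : MvPolynomial (Fin n) k | ∃ b : Fin n →₀ ℕ, N ≤ Finsupp.weight w b ∧ m = monomial b 1} :=
  Ideal.subset_span ⟨b, hb, rfl⟩

/-- A monomial with non-zero exponent vector lies in the ideal of the variables. [folklore] -/
theorem monomial_mem_span_X_of_ne_zero {k : Type} [Field k] {n : ℕ} (b : Fin n →₀ ℕ) (hb : b ≠ 0) :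
    (monomial b (1 : k) : MvPolynomial (Fin n) k) ∈
      Ideal.span (Set.range fun j : Fin n => (X j : MvPolynomial (Fin n) k)) := by
  obtain ⟨i, hi⟩ : ∃ i, b i ≠ 0 := by
    by_contra h
    push Not at h
    exact hb (Finsupp.ext h)
  have hdec : b = Finsupp.single i 1 + (b - Finsupp.single i 1) := by
    ext j
    simp only [Finsupp.coe_add, Pi.add_apply, Finsupp.coe_tsub, Pi.sub_apply, Finsupp.single_apply]
    split_ifs with h
    · subst h; omega
    · omega
  rw [hdec, monomial_single_add, pow_one]
  exact Ideal.mul_mem_right _ _ (Ideal.subset_span (Set.mem_range_self i))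

/-- The monomial ideal `I_N` (`N > 0`) lies in the ideal of the variables. [folklore] -/
theorem weightIdeal_le_span_X {k : Type} [Field k] {n : ℕ} (w : Fin n → ℕ) (N : ℕ) (hN : 0 < N) :
    Ideal.span {m : MvPolynomial (Fin n) k | ∃ b : Fin n →₀ ℕ, N ≤ Finsupp.weight w b ∧ m = monomial b 1} ≤
      Ideal.span (Set.range fun j : Fin n => (X j : MvPolynomial (Fin n) k)) := by
  rw [Ideal.span_le]
  rintro _ ⟨b, hb, rfl⟩
  refine monomial_mem_span_X_of_ne_zero b ?_
  rintro rfl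
  simp at hb
  omega

/-- **Off the origin via Jacobson**: in the Jacobson ring `R = k[X]/(f)`, a prime `P` not containing an
ideal `I ⊆ (x̄₀,…,x̄_{n-1})` lies in a maximal ideal `Q` missing some variable `x̄ⱼ` (a prime of a Jacobson
ring is the intersection of the maximal ideals containing it). [folklore] -/
theorem exists_maximal_not_mem_X {k : Type} [Field k] {n : ℕ} (f : MvPolynomial (Fin n) k)
    (I : Ideal (MvPolynomial (Fin n) k ⧸ Ideal.span {f}))
    (hI : I ≤ Ideal.span (Set.range fun j : Fin n => Ideal.Quotient.mk (Ideal.span {f}) (X j)))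
    (P : Ideal (MvPolynomial (Fin n) k ⧸ Ideal.span {f})) [P.IsPrime] (hP : ¬ I ≤ P) :
    ∃ (Q : Ideal (MvPolynomial (Fin n) k ⧸ Ideal.span {f})), Q.IsMaximal ∧ P ≤ Q ∧
      ∃ j : Fin n, Ideal.Quotient.mk (Ideal.span {f}) (X j) ∉ Q := by
  by_contra hcon
  push Not at hcon
  apply hP
  have hJ : P.jacobson = P := IsJacobsonRing.out inferInstance (Ideal.IsPrime.isRadical ‹_›)
  refine hI.trans ?_
  rw [← hJ, Ideal.jacobson, Ideal.span_le]
  rintro _ ⟨j, rfl⟩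
  simp only [SetLike.mem_coe, Ideal.mem_sInf, Set.mem_setOf_eq]
  rintro Q ⟨hPQ, hQ⟩
  exact hcon Q hQ hPQ j

/-- **THE WEIGHTED CONE ENGINE, CORE FORM** (see the module docstring): weights `w`, `N = c_v · w_v > 0`,
`I_N` with Veronese saturation, `(f)` prime with all `x̄_v ≠ 0`; if `R = k[X]/(f)` satisfies the clause at
the maximal ideals off the origin and every affine blow-up algebra `R[I_N R/x̄_v^{c_v}]` satisfies the
Cohen–Macaulay + Frobenius-closed clause at its maximal ideals containing `x̄_v^{c_v}`, then `Spec R` admits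
a proper birational model all of whose stalks are domains satisfying the per-stalk clause of
`FrobeniusLadder.FInjectiveMacaulayfication` (namely `affineBlowup (I_N R)`). [folklore] -/
theorem weightedConeFiModel_of_chartClause (p : ℕ) [Fact p.Prime] (k : Type) [Field k] [CharP k p] (n : ℕ)
    (w : Fin n → ℕ) (N : ℕ) (c : Fin n → ℕ) (hN : 0 < N) (hwc : ∀ v : Fin n, 0 < w v ∧ c v * w v = N)
    (hpow : ∀ (K : ℕ) (b : Fin n →₀ ℕ), K * N ≤ Finsupp.weight w b →
      (MvPolynomial.monomial b (1 : k) : MvPolynomial (Fin n) k) ∈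
        (Ideal.span {m : MvPolynomial (Fin n) k | ∃ b : Fin n →₀ ℕ, N ≤ Finsupp.weight w b ∧
          m = MvPolynomial.monomial b 1}) ^ K)
    (f : MvPolynomial (Fin n) k) (hfprime : (Ideal.span {f}).IsPrime)
    (hXne : ∀ v : Fin n, Ideal.Quotient.mk (Ideal.span {f}) (MvPolynomial.X v) ≠ 0)
    (hoff : ∀ (Q : Ideal (MvPolynomial (Fin n) k ⧸ Ideal.span {f})) [Q.IsMaximal],
      (∃ j : Fin n, Ideal.Quotient.mk (Ideal.span {f}) (MvPolynomial.X j) ∉ Q) →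
      ∀ d : ℕ, ringKrullDim (Localization.AtPrime Q) = d → ∀ s : Fin d → Localization.AtPrime Q,
        (Ideal.span (Set.range s)).radical.IsMaximal →
          RingTheory.Sequence.IsWeaklyRegular (Localization.AtPrime Q) (List.ofFn s) ∧
          ∀ y : Localization.AtPrime Q, (∃ e : ℕ, y ^ p ^ e ∈ Ideal.span
            ((fun z : Localization.AtPrime Q => z ^ p ^ e) ''
              (Ideal.span (Set.range s) : Set (Localization.AtPrime Q)))) → y ∈ Ideal.span (Set.range s))
    (hon : ∀ (v : Fin n) (Q : Ideal (blowupAlgebra ((Ideal.span {m : MvPolynomial (Fin n) k |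
        ∃ b : Fin n →₀ ℕ, N ≤ Finsupp.weight w b ∧ m = MvPolynomial.monomial b 1}).map
          (Ideal.Quotient.mk (Ideal.span {f}))) (Ideal.Quotient.mk (Ideal.span {f}) (MvPolynomial.X v) ^ c v)))
        [Q.IsMaximal],
      algebraMap (MvPolynomial (Fin n) k ⧸ Ideal.span {f}) (blowupAlgebra ((Ideal.span
        {m : MvPolynomial (Fin n) k | ∃ b : Fin n →₀ ℕ, N ≤ Finsupp.weight w b ∧
          m = MvPolynomial.monomial b 1}).map (Ideal.Quotient.mk (Ideal.span {f})))
            (Ideal.Quotient.mk (Ideal.span {f}) (MvPolynomial.X v) ^ c v))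
          (Ideal.Quotient.mk (Ideal.span {f}) (MvPolynomial.X v) ^ c v) ∈ Q →
      ∀ d : ℕ, ringKrullDim (Localization.AtPrime Q) = d → ∀ s : Fin d → Localization.AtPrime Q,
        (Ideal.span (Set.range s)).radical.IsMaximal →
          RingTheory.Sequence.IsWeaklyRegular (Localization.AtPrime Q) (List.ofFn s) ∧
          ∀ y : Localization.AtPrime Q, (∃ e : ℕ, y ^ p ^ e ∈ Ideal.span
            ((fun z : Localization.AtPrime Q => z ^ p ^ e) ''
              (Ideal.span (Set.range s) : Set (Localization.AtPrime Q)))) → y ∈ Ideal.span (Set.range s)) :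
    ∃ (X' : Scheme.{0}) (π : X' ⟶ Spec (.of (MvPolynomial (Fin n) k ⧸ Ideal.span {f}))), IsProper π ∧
      Literature.AlgebraicGeometry.Resolution.IsBirational π ∧
      ∀ y : X', IsDomain (X'.presheaf.stalk y) ∧ ∀ d : ℕ, ringKrullDim (X'.presheaf.stalk y) = d →
        ∀ s : Fin d → X'.presheaf.stalk y, (Ideal.span (Set.range s)).radical.IsMaximal →
          RingTheory.Sequence.IsWeaklyRegular (X'.presheaf.stalk y) (List.ofFn s) ∧
          ∀ z : X'.presheaf.stalk y, (∃ e : ℕ, z ^ p ^ e ∈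
              Ideal.span ((fun w : X'.presheaf.stalk y => w ^ p ^ e) ''
                (Ideal.span (Set.range s) : Set (X'.presheaf.stalk y)))) →
            z ∈ Ideal.span (Set.range s) := by
  haveI := hfprime
  -- `R = k[X]/(f)` is a Noetherian Jacobson domain of characteristic `p`
  haveI : IsDomain (MvPolynomial (Fin n) k ⧸ Ideal.span {f}) := Ideal.Quotient.isDomain _
  haveI : CharP (MvPolynomial (Fin n) k ⧸ Ideal.span {f}) p :=
    charP_of_injective_algebraMap (algebraMap k (MvPolynomial (Fin n) k ⧸ Ideal.span {f})).injective p
  rcases Nat.eq_zero_or_pos n with rfl | hn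
  · -- no variables: `R ≅ k` is regular and `Spec R` is its own model
    haveI := HypersurfacePointBlowup.isRegularRing_of_isEmpty k f hfprime
    exact ⟨Spec (.of (MvPolynomial (Fin 0) k ⧸ Ideal.span {f})), 𝟙 _, inferInstance,
      ⟨⊤, by simp [dense_univ], by simp [dense_univ], inferInstance⟩,
      HypersurfacePointBlowup.spec_stalk_clause p (MvPolynomial (Fin 0) k ⧸ Ideal.span {f})⟩
  -- names: the centre `I = I_N · R` and the covering sub-family `v j = x̄ⱼ ^ cⱼ`
  obtain ⟨I, hI⟩ : ∃ I : Ideal (MvPolynomial (Fin n) k ⧸ Ideal.span {f}),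
      I = (Ideal.span {m : MvPolynomial (Fin n) k | ∃ b : Fin n →₀ ℕ, N ≤ Finsupp.weight w b ∧
        m = MvPolynomial.monomial b 1}).map (Ideal.Quotient.mk (Ideal.span {f})) := ⟨_, rfl⟩
  obtain ⟨v, hv⟩ : ∃ v : Fin n → MvPolynomial (Fin n) k ⧸ Ideal.span {f},
      v = fun j => Ideal.Quotient.mk (Ideal.span {f}) (MvPolynomial.X j) ^ c j := ⟨_, rfl⟩
  have hc : ∀ j : Fin n, 0 < c j := fun j => Nat.pos_of_ne_zero fun h => by
    have h2 := (hwc j).2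
    rw [h, zero_mul] at h2
    omega
  -- `X j ^ c j ∈ I_N`
  have hXcI : ∀ j : Fin n, (X j : MvPolynomial (Fin n) k) ^ c j ∈
      Ideal.span {m : MvPolynomial (Fin n) k | ∃ b : Fin n →₀ ℕ, N ≤ Finsupp.weight w b ∧
        m = MvPolynomial.monomial b 1} := by
    intro j
    rw [X_pow_eq_monomial]
    refine monomial_mem_weightIdeal w N _ ?_
    rw [Finsupp.weight_single, smul_eq_mul, (hwc j).2]
  -- `v j ∈ I`, `v j ≠ 0`, `I ≠ 0`
  have hvI : ∀ j : Fin n, v j ∈ I := by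
    intro j
    rw [hv, hI]
    dsimp only
    rw [← map_pow]
    exact Ideal.mem_map_of_mem _ (hXcI j)
  have hv0 : ∀ j : Fin n, v j ≠ 0 := fun j => by
    rw [hv]
    exact pow_ne_zero _ (hXne j)
  have hI0 : I ≠ ⊥ := fun h => hv0 ⟨0, hn⟩ (by simpa [h] using hvI ⟨0, hn⟩)
  -- the centre lies in the ideal of the variables
  have hIle : I ≤ Ideal.span (Set.range fun j : Fin n =>
      Ideal.Quotient.mk (Ideal.span {f}) (MvPolynomial.X j)) := by
    rw [hI, show (Set.range fun j : Fin n => Ideal.Quotient.mk (Ideal.span {f}) (MvPolynomial.X j)) =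
      Ideal.Quotient.mk (Ideal.span {f}) '' Set.range (fun j : Fin n => (X j : MvPolynomial (Fin n) k)) from
      by rw [← Set.range_comp]; rfl, ← Ideal.map_span]
    exact Ideal.map_mono (weightIdeal_le_span_X w N hN)
  -- THE COVER: every generator `x̄^b`, `wt b ≥ N`, has `(x̄^b)^{c_j} = x̄ⱼ^{c_j} · x̄^{b'}`, `x̄^{b'} ∈ I^{c_j - 1}`
  have hcov : (HomogeneousIdeal.irrelevant (reesGrading I)).toIdeal ≤
      (Ideal.span (Set.range fun j : Fin n => reesT (I := I) (v j) (hvI j))).radical := by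
    refine ReesCoverOfPowers.stub_reesCoverOfPowers _ I
      (Ideal.Quotient.mk (Ideal.span {f}) '' {m : MvPolynomial (Fin n) k | ∃ b : Fin n →₀ ℕ,
        N ≤ Finsupp.weight w b ∧ m = MvPolynomial.monomial b 1}) (by rw [hI, Ideal.map_span]) n v hvI ?_
    rintro _ ⟨_, ⟨b, hb, rfl⟩, rfl⟩
    -- `b ≠ 0`: pick a variable `j` occurring in `b`
    obtain ⟨j, hj⟩ : ∃ j, b j ≠ 0 := by
      by_contra h
      push Not at h
      have hb0 : b = 0 := Finsupp.ext h
      subst hb0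
      simp at hb
      omega
    have hle : Finsupp.single j (c j) ≤ c j • b := Finsupp.single_le_iff.mpr (by
      rw [Finsupp.smul_apply, smul_eq_mul]
      exact Nat.le_mul_of_pos_right _ (Nat.pos_of_ne_zero hj))
    have hsplit : c j • b = Finsupp.single j (c j) + (c j • b - Finsupp.single j (c j)) := by
      rw [add_comm, tsub_add_cancel_of_le hle]
    refine ⟨j, c j, hc j, Ideal.Quotient.mk (Ideal.span {f})
      (MvPolynomial.monomial (c j • b - Finsupp.single j (c j)) 1), ?_, ?_⟩
    · -- `x̄^{b'} ∈ I ^ (c_j - 1)` by the Veronese saturation hypothesis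
      rw [hI, ← Ideal.map_pow]
      refine Ideal.mem_map_of_mem _ (hpow (c j - 1) _ ?_)
      have hwt : Finsupp.weight w (c j • b) =
          N + Finsupp.weight w (c j • b - Finsupp.single j (c j)) := by
        conv_lhs => rw [hsplit]
        rw [map_add, Finsupp.weight_single, smul_eq_mul, (hwc j).2]
      have hwt' : Finsupp.weight w (c j • b) = c j * Finsupp.weight w b := by
        rw [map_nsmul, smul_eq_mul]
      have h1 : c j * N ≤ c j * Finsupp.weight w b := Nat.mul_le_mul_left _ hb
      have h2 : (c j - 1) * N + N = c j * N := by
        rcases Nat.exists_eq_succ_of_ne_zero (hc j).ne' with ⟨e, he⟩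
        rw [he, Nat.succ_sub_one, Nat.succ_mul]
      omega
    · -- the identity `(x̄^b)^{c_j} = x̄ⱼ^{c_j} · x̄^{b'}`
      rw [hv]
      show _ = Ideal.Quotient.mk (Ideal.span {f}) (X j) ^ c j * _
      rw [← map_pow (Ideal.Quotient.mk (Ideal.span {f})) (X j),
        ← map_pow (Ideal.Quotient.mk (Ideal.span {f})) (MvPolynomial.monomial b (1 : k)), ← map_mul]
      congr 1
      rw [MvPolynomial.monomial_pow, one_pow, X_pow_eq_monomial, MvPolynomial.monomial_mul, one_mul, ← hsplit]
  -- OFF THE CENTRE (Jacobson): a prime `P ⊉ I` generalises a closed point off the origin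
  have hoff' : ∀ (P : Ideal (MvPolynomial (Fin n) k ⧸ Ideal.span {f})) [P.IsPrime], ¬ I ≤ P →
      IsDomain (Localization.AtPrime P) ∧
      ∀ d : ℕ, ringKrullDim (Localization.AtPrime P) = d → ∀ s : Fin d → Localization.AtPrime P,
        (Ideal.span (Set.range s)).radical.IsMaximal →
          RingTheory.Sequence.IsWeaklyRegular (Localization.AtPrime P) (List.ofFn s) ∧
          ∀ y : Localization.AtPrime P, (∃ e : ℕ, y ^ p ^ e ∈ Ideal.span
            ((fun z : Localization.AtPrime P => z ^ p ^ e) ''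
              (Ideal.span (Set.range s) : Set (Localization.AtPrime P)))) → y ∈ Ideal.span (Set.range s) := by
    intro P _ hP
    obtain ⟨Q, hQ, hPQ, j, hj⟩ := exists_maximal_not_mem_X f I hIle P hP
    haveI := hQ
    exact ClauseOfMaximal.fiClause_atPrime_of_le p hPQ ⟨inferInstance, hoff Q ⟨j, hj⟩⟩
  -- ON THE EXCEPTIONAL LOCUS, chart by chart: the hypothesis `hon`
  have hon' : ∀ (j : Fin n) (Q : Ideal (blowupAlgebra I (v j))) [Q.IsMaximal],
      algebraMap (MvPolynomial (Fin n) k ⧸ Ideal.span {f}) (blowupAlgebra I (v j)) (v j) ∈ Q →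
      ∀ d : ℕ, ringKrullDim (Localization.AtPrime Q) = d → ∀ s : Fin d → Localization.AtPrime Q,
        (Ideal.span (Set.range s)).radical.IsMaximal →
          RingTheory.Sequence.IsWeaklyRegular (Localization.AtPrime Q) (List.ofFn s) ∧
          ∀ y : Localization.AtPrime Q, (∃ e : ℕ, y ^ p ^ e ∈ Ideal.span
            ((fun z : Localization.AtPrime Q => z ^ p ^ e) ''
              (Ideal.span (Set.range s) : Set (Localization.AtPrime Q)))) → y ∈ Ideal.span (Set.range s) := by
    subst hI hv
    intro j Q _ hQ
    exact hon j Q hQ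
  exact BlowupFiModelOfCover.stub_blowupFiModelOfCover p (MvPolynomial (Fin n) k ⧸ Ideal.span {f}) I n v
    hvI hI0 hv0 hcov hoff' hon'

end Summit.ResolutionOfSingularities.ResolutionOfSingularities.Theorems.FInjectiveMacaulayfication.WeightedConeCore
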